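import Summits.KontsevichZagierPeriods.KontsevichZagierPeriods.Theorems.FermatIsogenyBetaLinearSectorSixthsStubIsogenyNeg
import Summits.KontsevichZagierPeriods.KontsevichZagierPeriods.Theorems.FermatIsogenyBetaLinearSectorSixthsStubIsogenyMid
import Summits.KontsevichZagierPeriods.KontsevichZagierPeriods.Theorems.FermatIsogenyBetaLinearSectorSixthsStubIsogenyPos
import HarnessLib

/-!
# `BetaLinearSector` (stmt-KontsevichZagierPeriods-3897), line `fermat-sector-transport` —
# stub `stub_isoThree_secondKind_arcs` (second-kind pull-back along the real 3-isogeny, arcs `(−1, 0)` and `(0, 2)`)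

Level `6` of the crux `BetaLinearSector` (route FermatIsogeny) needs, inside the Kontsevich–Zagier
calculus of moves (`KZ.Equivalent`), links among the ten Beta cells of the class `π²/Γ(1/3)³`.
These are periods of the SECOND kind of the CM curves `E₊ : y² = x³ + 1` and `E₋ : Y² = X³ − 1`,
and they are transported by the same REAL `3`-ISOGENY `ψ : E₊ → E₋` as the first-kind periods
(`stub_isogenyThree_piece_neg/mid/pos`): its `x`-map is `X(x) = (x³ + 4)/(3x²)`, with
`X′(x) = (x³ − 8)/(3x³)`, `(x³ + 4)³ − 27x⁶ = (x³ + 1)(x³ − 8)²` and `ψ^*(dX/Y) = √3·dx/y`.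
For the second-kind form `dX/(X²Y)` the rule-(2) Jacobian identity is the first-kind one
multiplied by `1/X(x)² = 9x⁴/(x³ + 4)²`:

  `(1/(X²√(X³ − 1)))·|X′| = (9x⁴/(x³ + 4)²)·(√3/√(x³ + 1)) = 9√3·x⁴/((x³ + 4)²·√(x³ + 1))`

(`isoSK_arcs_jacobian_of`, pure algebra on top of `isoNeg_jacobian` / `isoMid_jacobian`).
Everything else of the move — `X` is a pole-free `ℚ`-rational function on each arc, injective
there with derivative `X′`, and maps `(−1, 0)` (increasingly) and `(0, 2)` (decreasingly) onto
`(1, ∞)` — is literally the landed real algebra of the first-kind files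
(`isoNeg_injective`, `isoNeg_exists_eq`, `isoNeg_hasDerivAt`, `isoNeg_one_lt`, `isoMid_*`,
`isoPos_hasDerivAt_xMap`). Hence for `S = [A, 9√3x⁴/((x³+4)²√(x³+1))]` on either bounded arc
`A ∈ {(−1, 0), (0, 2)}` and `T = [(1, ∞), 1/(X²√(X³−1))]` (integrands prescribed on the domains
only), `[S] − [T]` is ONE change-of-variables move (`isoSK_neg_equivalent`, `isoSK_mid_equivalent`),
packaged in `ℝ¹` by `of_sub_of_mem_changeOfVariablesRel_dimOne`; the registered stub
`stub_isoThree_secondKind_arcs` is the disjunction of the two arcs. The unbounded arc `(2, ∞)` is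
the neighbouring stub `stub_isoThree_secondKind_tail` (not treated here).

References: M. Kontsevich, D. Zagier, *Periods* (2001), §1.2 rule (2); J. H. Silverman,
*The Arithmetic of Elliptic Curves* (2009), III.4 (Vélu's `3`-isogeny with kernel the flexes
`(0, ±1)` of `y² = x³ + 1`).
-/

noncomputable section

namespace Summit.KontsevichZagierPeriods.FermatIsogeny.BetaLinearSector.Sixths

open Set MeasureTheory
open MvPolynomial (aeval X C)
open Literature.NumberTheory.Transcendental
open Summit.KontsevichZagierPeriods.HermiteRigidity.CMTwistQuasiPeriodTransfer
  (of_sub_of_mem_changeOfVariablesRel_dimOne)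
open Summit.KontsevichZagierPeriods.KontsevichZagierPeriods.Theorems.GKZLevelThree
  (isSemialgebraicFunOn_ratFun₁)

/-! ## The second-kind Jacobian identity along `X(x) = (x³ + 4)/(3x²)` -/

/-- **From the first-kind to the second-kind Jacobian identity.** If
`√3/√(x³ + 1) = (1/√(X(x)³ − 1))·|X′(x)|` (the pull-back `ψ^*(dX/Y) = √3·dx/y`), then
`9√3·x⁴/((x³ + 4)²·√(x³ + 1)) = (1/(X(x)²·√(X(x)³ − 1)))·|X′(x)|` (the pull-back of the
second-kind form `dX/(X²Y)`), since `1/X(x)² = 9x⁴/(x³ + 4)²`. Pure algebra.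
[cite: KontsevichZagier2001, §1.2 rule (2)] -/
theorem isoSK_arcs_jacobian_of {x : ℝ}
    (hJ : Real.sqrt 3 / Real.sqrt (x ^ 3 + 1) =
      1 / Real.sqrt (((x ^ 3 + 4) / (3 * x ^ 2)) ^ 3 - 1) * |(x ^ 3 - 8) / (3 * x ^ 3)|) :
    9 * Real.sqrt 3 * x ^ 4 / ((x ^ 3 + 4) ^ 2 * Real.sqrt (x ^ 3 + 1)) =
      1 / (((x ^ 3 + 4) / (3 * x ^ 2)) ^ 2 * Real.sqrt (((x ^ 3 + 4) / (3 * x ^ 2)) ^ 3 - 1)) *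
        |(x ^ 3 - 8) / (3 * x ^ 3)| := by
  set φ : ℝ := (x ^ 3 + 4) / (3 * x ^ 2) with hφ
  set R : ℝ := Real.sqrt (φ ^ 3 - 1) with hR
  set A : ℝ := |(x ^ 3 - 8) / (3 * x ^ 3)| with hA
  rw [show 1 / (φ ^ 2 * R) * A = 1 / φ ^ 2 * (1 / R * A) by ring, ← hJ, hφ, div_pow, one_div_div,
    div_mul_div_comm]
  ring

/-! ## The arc `(−1, 0)` -/

/-- **Second-kind transport on the arc `(−1, 0)`.** For any representations
`S = [{−1 < p 0 < 0}, 9√3x⁴/((x³+4)²√(x³+1))]` and `T = [{1 < p 0}, 1/(x²√(x³−1))]` (integrands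
prescribed on the domains only), `KZ.Equivalent S T`: ONE change of variables (rule (2)) along
the `x`-map `X(x) = (x³+4)/(3x²)` of the real `3`-isogeny `y² = x³ + 1 → Y² = X³ − 1`
(`ℚ`-rational, pole-free, injective with derivative `(x³−8)/(3x³)` on the arc, image `(1, ∞)`),
with the exact Jacobian identity `isoSK_arcs_jacobian_of (isoNeg_jacobian _ _)`.
[cite: KontsevichZagier2001, §1.2 rule (2)] -/
theorem isoSK_neg_equivalent (S T : KZ.IntegralRep 1)
    (hSd : S.domain = {x | -1 < x 0 ∧ x 0 < 0})
    (hSi : Set.EqOn S.integrand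
      (fun x => 9 * Real.sqrt 3 * x 0 ^ 4 / ((x 0 ^ 3 + 4) ^ 2 * Real.sqrt (x 0 ^ 3 + 1))) S.domain)
    (hTd : T.domain = {x | 1 < x 0})
    (hTi : Set.EqOn T.integrand (fun x => 1 / (x 0 ^ 2 * Real.sqrt (x 0 ^ 3 - 1))) T.domain) :
    KZ.Equivalent S T := by
  set φ : ℝ → ℝ := fun y => (y ^ 3 + 4) / (3 * y ^ 2) with hφ
  set φ' : ℝ → ℝ := fun y => (y ^ 3 - 8) / (3 * y ^ 3) with hφ'
  have hmem : ∀ p ∈ S.domain, -1 < p 0 ∧ p 0 < 0 := fun p hp => by rwa [hSd] at hp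
  refine KZ.changeOfVariablesRel_subset_relations
    (of_sub_of_mem_changeOfVariablesRel_dimOne S T φ φ'
      ?_ (fun p hp => isoNeg_hasDerivAt (hmem p hp).2) ?_ ?_ ?_)
  · -- `Φ` is `ℚ`-semialgebraic on the arc (a pole-free quotient of `ℚ`-polynomials)
    refine isSemialgebraicFunOn_ratFun₁ S.isSemialgebraic_domain (X 0 ^ 3 + 4) (3 * X 0 ^ 2) φ
      (fun p hp => ?_) (fun p _ => ?_)
    · simp only [map_mul, map_pow, MvPolynomial.aeval_X, map_ofNat]
      exact mul_ne_zero three_ne_zero (pow_ne_zero 2 (hmem p hp).2.ne)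
    · simp only [hφ, map_mul, map_add, map_pow, MvPolynomial.aeval_X, map_ofNat]
  · -- injective on the arc
    intro p hp q hq h
    exact isoNeg_injective (hmem p hp).2 (hmem q hq).2 h
  · -- the image of the arc is `(1, ∞)`
    rw [hTd, hSd]
    ext q
    simp only [mem_setOf_eq, mem_image]
    constructor
    · intro hq
      obtain ⟨x, hx1, hx2, hx⟩ := isoNeg_exists_eq hq
      exact ⟨fun _ => x, ⟨hx1, hx2⟩, funext fun i => by rw [Subsingleton.elim i 0]; exact hx⟩
    · rintro ⟨p, ⟨hp1, hp2⟩, rfl⟩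
      exact isoNeg_one_lt hp1 hp2
  · -- the second-kind Jacobian identity on the arc
    intro p hp
    obtain ⟨hp1, hp2⟩ := hmem p hp
    have hφp : (fun _ : Fin 1 => φ (p 0)) ∈ T.domain := by
      rw [hTd]
      exact isoNeg_one_lt hp1 hp2
    rw [hSi hp, hTi hφp]
    exact isoSK_arcs_jacobian_of (isoNeg_jacobian hp1 hp2)

/-! ## The arc `(0, 2)` -/

/-- **Second-kind transport on the arc `(0, 2)`.** For any representations
`S = [{0 < p 0 < 2}, 9√3x⁴/((x³+4)²√(x³+1))]` and `T = [{1 < p 0}, 1/(x²√(x³−1))]` (integrands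
prescribed on the domains only), `KZ.Equivalent S T`: ONE change of variables (rule (2)) along
`X(x) = (x³+4)/(3x²)` (`ℚ`-rational, pole-free, injective with derivative `(x³−8)/(3x³) < 0` on
the arc, image `(1, ∞)`), with the exact Jacobian identity
`isoSK_arcs_jacobian_of (isoMid_jacobian _ _)`. [cite: KontsevichZagier2001, §1.2 rule (2)] -/
theorem isoSK_mid_equivalent (S T : KZ.IntegralRep 1)
    (hSd : S.domain = {x | 0 < x 0 ∧ x 0 < 2})
    (hSi : Set.EqOn S.integrand
      (fun x => 9 * Real.sqrt 3 * x 0 ^ 4 / ((x 0 ^ 3 + 4) ^ 2 * Real.sqrt (x 0 ^ 3 + 1))) S.domain)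
    (hTd : T.domain = {x | 1 < x 0})
    (hTi : Set.EqOn T.integrand (fun x => 1 / (x 0 ^ 2 * Real.sqrt (x 0 ^ 3 - 1))) T.domain) :
    KZ.Equivalent S T := by
  set φ : ℝ → ℝ := fun y => (y ^ 3 + 4) / (3 * y ^ 2) with hφ
  set φ' : ℝ → ℝ := fun y => (y ^ 3 - 8) / (3 * y ^ 3) with hφ'
  have hmem : ∀ p ∈ S.domain, 0 < p 0 ∧ p 0 < 2 := fun p hp => by rwa [hSd] at hp
  refine KZ.changeOfVariablesRel_subset_relations
    (of_sub_of_mem_changeOfVariablesRel_dimOne S T φ φ'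
      ?_ (fun p hp => isoPos_hasDerivAt_xMap (hmem p hp).1.ne') ?_ ?_ ?_)
  · -- `Φ` is `ℚ`-semialgebraic on the arc (a pole-free quotient of `ℚ`-polynomials)
    refine isSemialgebraicFunOn_ratFun₁ S.isSemialgebraic_domain (X 0 ^ 3 + 4) (3 * X 0 ^ 2) φ
      (fun p hp => ?_) (fun p _ => ?_)
    · simp only [map_mul, map_pow, MvPolynomial.aeval_X, map_ofNat]
      exact (mul_pos three_pos (pow_pos (hmem p hp).1 2)).ne'
    · simp only [hφ, map_mul, map_add, map_pow, MvPolynomial.aeval_X, map_ofNat]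
  · -- injective on the arc
    intro p hp q hq h
    exact isoMid_phi_injective (hmem p hp).1 (hmem p hp).2 (hmem q hq).1 (hmem q hq).2 h
  · -- the image of the arc is `(1, ∞)`
    rw [hTd, hSd]
    ext q
    simp only [mem_setOf_eq, mem_image]
    constructor
    · intro hq
      obtain ⟨x, hx1, hx2, hx⟩ := isoMid_exists_phi_eq hq
      exact ⟨fun _ => x, ⟨hx1, hx2⟩, funext fun i => by rw [Subsingleton.elim i 0]; exact hx⟩
    · rintro ⟨p, ⟨hp1, hp2⟩, rfl⟩
      exact isoMid_one_lt_phi hp1 hp2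
  · -- the second-kind Jacobian identity on the arc
    intro p hp
    obtain ⟨hp1, hp2⟩ := hmem p hp
    have hφp : (fun _ : Fin 1 => φ (p 0)) ∈ T.domain := by
      rw [hTd]
      exact isoMid_one_lt_phi hp1 hp2
    rw [hSi hp, hTi hφp]
    exact isoSK_arcs_jacobian_of (isoMid_jacobian hp1 hp2)

/-! ## The registered stub -/

/-- **Stub `stub_isoThree_secondKind_arcs`** (line `fermat-sector-transport` of `BetaLinearSector`,
level `6`): on either bounded arc `(a, b) ∈ {(−1, 0), (0, 2)}` of `y² = x³ + 1`, any
representations `S = [(a, b), 9√3x⁴/((x³+4)²√(x³+1))]` and `T = [(1, ∞), 1/(X²√(X³−1))]`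
(integrands prescribed on the domains only) are `KZ.Equivalent`: ONE change-of-variables move
(Kontsevich–Zagier rule (2)) along the `x`-map `X = (x³+4)/(3x²)` of the real `3`-isogeny
`y² = x³ + 1 → Y² = X³ − 1`, which pulls the second-kind form `dX/(X²Y)` back to
`9√3·x⁴dx/((x³+4)²y)`. [cite: KontsevichZagier2001, §1.2 rule (2)] -/
theorem stub_isoThree_secondKind_arcs : ∀ (S T : KZ.IntegralRep 1) (a b : ℝ), ((a = -1 ∧ b = 0) ∨ (a = 0 ∧ b = 2)) →
    S.domain = {x | a < x 0 ∧ x 0 < b} →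
    Set.EqOn S.integrand (fun x => 9 * Real.sqrt 3 * x 0 ^ 4 / ((x 0 ^ 3 + 4) ^ 2 * Real.sqrt (x 0 ^ 3 + 1))) S.domain →
    T.domain = {x | 1 < x 0} →
    Set.EqOn T.integrand (fun x => 1 / (x 0 ^ 2 * Real.sqrt (x 0 ^ 3 - 1))) T.domain → KZ.Equivalent S T := by
  intro S T a b hab hSd hSi hTd hTi
  rcases hab with ⟨rfl, rfl⟩ | ⟨rfl, rfl⟩
  · exact isoSK_neg_equivalent S T hSd hSi hTd hTi
  · exact isoSK_mid_equivalent S T hSd hSi hTd hTi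

end Summit.KontsevichZagierPeriods.FermatIsogeny.BetaLinearSector.Sixths

end
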